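import Mathlib
import HarnessLib
import Summits.HubbardSuperconductivity.HubbardSuperconductivity.Theorems.KLProgrammeKLRegimeFatOverlapCount
import Summits.HubbardSuperconductivity.HubbardSuperconductivity.Theorems.KLProgrammeKLRegimeSliceAlphaFatMono
import Summits.HubbardSuperconductivity.HubbardSuperconductivity.Theorems.KLProgrammeKLRegimeIntegerTangentNorm
import Summits.HubbardSuperconductivity.HubbardSuperconductivity.Theorems.KLProgrammeKLRegimeSectorSliceAlpha
import Summits.HubbardSuperconductivity.HubbardSuperconductivity.Theorems.KLProgrammeKLRegimeSliceTangencyBridge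
import Summits.HubbardSuperconductivity.HubbardSuperconductivity.Theorems.KLProgrammeKLRegimeFramePosKernelL1

/-!
# Route `KLProgramme` — engine support, route (L2), FAT layer 4b: the per-pair character-sum bound for the FAT sector family
# `Ft = bgmFatMultiplier … (m+1)` and the zero-seed counterterm slice covariance on an admissible frame, UNIFORM over sector pairs

Cell `gate-hubbard-kl`, seat hubbard-kl-k3c2-p3; gen-4 ENGINE child stmt-HubbardSuperconductivity-19855 (`stub_engine_step_norms`, `α_n`).
**`slicePair_bgmFat_le`**: for every pair `(ω, ω′)` and every integer frame vector `v` of the sector `ω` (`|v_j| ≤ N_r + ½`, `|v| ≥ N_r − 1`,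
tangency `|De_K(p_F(θ_ω))·(2π/L)v| ≤ (2π/L)(4+2A)`), the per-pair `ℓ¹` norm is `≤ √W·√(16·2M·L²·N̄_s)·(βL²)⁻²·4βL²/Λ` given the five rate
inequalities on UNIFORM data (pair dependence removed by `…SliceAlphaFatMono`; multiplier data from `…FatMultiplierPack` at radial scale
`m`, angular scale `m+1`, index sets `S_ω, S_{ω′}`, centre `θ_ω`, displacement `Lip·w_{m+1}`).  Everything is proved; no definitions. [folklore]
(BGM 2006 §2.7 (2.66)–(2.71a), §2.8 (2.81), Lemma 2.2.)
-/

noncomputable section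

namespace Summit.HubbardSuperconductivity.HubbardSuperconductivity.Theorems.TorusFourierL2

set_option linter.dupNamespace false -- summit = problem name (single-conjunct summit), D-0017

open Set Finset Literature.MathematicalPhysics.QuantumLattice Literature.MathematicalPhysics.QuantumLattice.BandSectorCounting
open Literature.MathematicalPhysics.QuantumLattice.FermiRG Literature.Probability.LatticeModels Literature.Analysis.SpecialFunctions
open Summit.HubbardSuperconductivity.HubbardSuperconductivity.Theorems.DispersionFlow
open Summit.HubbardSuperconductivity.HubbardSuperconductivity.Theorems.KLRegimeSplit
open Summit.HubbardSuperconductivity.HubbardSuperconductivity.Theorems.KLProgrammeLegKernels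
open Summit.HubbardSuperconductivity.HubbardSuperconductivity.Theorems.PerturbedFermiCurve
open scoped Real Nat

section PairBound

open Classical

variable {L M : ℕ} [NeZero L] [NeZero M] {a b : ℝ} (B : BandBounds a b) {K : TrigPolyC4v} {A : ℝ}
  (hA : ∀ p : Momentum, ∀ j ≤ 2, ‖iteratedFDeriv ℝ j (frameShift K) p‖ ≤ A) (hADt : 2 * A < B.Dtmin)
  {μ e₀ z β : ℝ} (he : 0 < e₀) (hz : 0 < z) (hz1 : z ≤ 1) (hgap : e₀ + A + z ^ 2 < -μ) (h3 : e₀ + A - μ ≤ 3)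
  (hlo : a ≤ μ - A - e₀) (hhi : μ + A + e₀ ≤ b) (hβ : 0 < β) (hρA : 4 * A < 2 * B.rhomin)
  (m : ℕ) (hMm : klScale e₀ m * β < π * (2 * M - 3))
  {d : ℝ} (hd : 0 ≤ d) (hd1 : ∀ u, |deriv (bgmCutoffSq e₀) u| ≤ d) (hd2 : ∀ u, |iteratedDeriv 2 (bgmCutoffSq e₀) u| ≤ d)
  {Ba : ℝ} (hB0 : 0 ≤ Ba)
  (hB : ∀ (i : ℕ), i ≤ 2 → ∀ (n : ℕ) (ω : ℤ) (θ₀ : ℝ) (q w : Fin 2 → ℝ) (t : ℝ) {r₀ : ℝ}, 0 < r₀ →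
    r₀ ≤ ‖momToComplex (q + t • w)‖ → |sectorRelAngle θ₀ (q + t • w)| < π →
    ‖iteratedDeriv i (fun t : ℝ => sectorWeightCirc n ω (polarAngle (q + t • w))) t‖ ≤
      (2 : ℕ)! * Ba * ((1 + (sectorWidth n)⁻¹ * (2 : ℕ)!) * ‖momToComplex w‖ / r₀) ^ i)
  -- the slice and the Euclidean frame data of the propagator side
  {Λ Λ' : ℝ} (hΛ : 0 < Λ) (hΛΛ' : Λ ≤ Λ') (hM' : Λ' < π * (2 * M - 3) / β)
  {K₁ K₂ : ℝ} (hK₁ : ∀ p, ‖fderiv ℝ (frameLevel μ K) p‖ ≤ K₁) (hK₂ : ∀ p, ‖iteratedFDeriv ℝ 2 (frameLevel μ K) p‖ ≤ K₂)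
  {B₁ B₂ : ℝ} (hB₁ : ∀ x, |deriv salmhoferCutoff x| ≤ B₁) (hB₂ : ∀ x, |deriv (deriv salmhoferCutoff) x| ≤ B₂)
  -- tangent resolution, zone margin for the steps, far-region radius
  {Nr : ℝ} (hNr : 2 ≤ Nr) (hLz : 2 * |2 * π / L| * (Nr + 1 / 2) ≤ z) {R₀ : ℕ} (hR₀ : 2 * (2 * Nr + 1) * (R₀ : ℝ) < L)
  -- abbreviations (instantiate with `rfl`)
  {ℓ₁ ℓ ρf G₁ G₂ Kp wsi τt Ae1 Ae2 An1 An2 Av1 Av2 : ℝ}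
  (hℓ₁ : ℓ₁ = 2 * π / L) (hℓ : ℓ = 2 * π / L * (Nr + 1 / 2))
  (hρf : ρf = (klScale e₀ m + B.smax * B.Dtmin * (3 * sectorWidth (m + 1) / 4)) / (B.Dtmin - 2 * A) +
    π * Real.sqrt 2 * (1 + (4 + 2 * A) / (B.Dtmin - 2 * A)) * sectorWidth (m + 1))
  (hG₁ : G₁ = d * e₀ ^ 2 * 1 + 1 * (d * e₀ ^ 2)) (hG₂ : G₂ = d * e₀ ^ 4 * 1 + 2 * (d * e₀ ^ 2) * (d * e₀ ^ 2) + 1 * (d * e₀ ^ 4))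
  (hKp : Kp = 4 + 4 * A) (hwsi : wsi = (sectorWidth (m + 1))⁻¹)
  (hτt : τt = |2 * π / L| * (4 + 2 * A) + K₂ * (Real.sqrt 2 * ρf) * (Real.sqrt 2 * ℓ))
  (hAe1 : Ae1 = 2 * G₁ * ((4 + 2 * A) * ℓ₁ + Kp * (ρf + 2 * ℓ₁) * ℓ₁) / klScale e₀ m * 1 + 1 * 1 * (9 * (4 * Ba * ((1 + 2 * wsi) * (2 * ℓ₁)))))
  (hAe2 : Ae2 = ((4 * G₂ + 2 * G₁) * ((4 + 2 * A) * ℓ₁ + Kp * (ρf + 2 * ℓ₁) * ℓ₁) ^ 2 / klScale e₀ m ^ 2 + 2 * G₁ * (Kp * ℓ₁ ^ 2) / klScale e₀ m) * 1 +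
    4 * G₁ * ((4 + 2 * A) * ℓ₁ + Kp * (ρf + 2 * ℓ₁) * ℓ₁) / klScale e₀ m * (9 * (4 * Ba * ((1 + 2 * wsi) * (2 * ℓ₁)))) +
    1 * 1 * (9 * (4 * Ba * ((1 + 2 * wsi) * (2 * ℓ₁)) ^ 2 + 8 * Ba ^ 2 * ((1 + 2 * wsi) * (2 * ℓ₁)) ^ 2)))
  (hAn1 : An1 = 2 * G₁ * ((4 + 2 * A) * ℓ + Kp * (ρf + 2 * ℓ) * ℓ) / klScale e₀ m * 1 + 1 * 1 * (9 * (4 * Ba * ((1 + 2 * wsi) * (2 * ℓ)))))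
  (hAn2 : An2 = ((4 * G₂ + 2 * G₁) * ((4 + 2 * A) * ℓ + Kp * (ρf + 2 * ℓ) * ℓ) ^ 2 / klScale e₀ m ^ 2 + 2 * G₁ * (Kp * ℓ ^ 2) / klScale e₀ m) * 1 +
    4 * G₁ * ((4 + 2 * A) * ℓ + Kp * (ρf + 2 * ℓ) * ℓ) / klScale e₀ m * (9 * (4 * Ba * ((1 + 2 * wsi) * (2 * ℓ)))) +
    1 * 1 * (9 * (4 * Ba * ((1 + 2 * wsi) * (2 * ℓ)) ^ 2 + 8 * Ba ^ 2 * ((1 + 2 * wsi) * (2 * ℓ)) ^ 2)))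
  (hAv1 : Av1 = 2 * G₁ * (|2 * π / L| * (4 + 2 * A) + Kp * (ρf + 2 * ℓ) * ℓ) / klScale e₀ m * 1 + 1 * 1 * (9 * (4 * Ba * ((1 + 2 * wsi) * (2 * ℓ)))))
  (hAv2 : Av2 = ((4 * G₂ + 2 * G₁) * (|2 * π / L| * (4 + 2 * A) + Kp * (ρf + 2 * ℓ) * ℓ) ^ 2 / klScale e₀ m ^ 2 + 2 * G₁ * (Kp * ℓ ^ 2) / klScale e₀ m) * 1 +
    4 * G₁ * (|2 * π / L| * (4 + 2 * A) + Kp * (ρf + 2 * ℓ) * ℓ) / klScale e₀ m * (9 * (4 * Ba * ((1 + 2 * wsi) * (2 * ℓ)))) +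
    1 * 1 * (9 * (4 * Ba * ((1 + 2 * wsi) * (2 * ℓ)) ^ 2 + 8 * Ba ^ 2 * ((1 + 2 * wsi) * (2 * ℓ)) ^ 2)))
  -- rates and the five UNIFORM inequalities
  {s₀ s₁ s₂ s₃ : ℝ} (hs₀ : 0 < s₀) (hs₁ : 0 < s₁) (hs₂ : 0 < s₂) (hs₃ : 0 < s₃)
  (hr₀ : (1 / (β * (L : ℝ) ^ 2)) ^ 2 *
      (1 * ((2 * π / β) ^ 2 * ((32 * B₂ + 144 * B₁ + 128) * (β * (L : ℝ) ^ 2) / Λ ^ 3)) +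
        2 * ((2 * G₁ * |2 * π / β| * 1 / klScale e₀ m) * ((2 * π / β) * ((16 * B₁ + 16) * (β * (L : ℝ) ^ 2) / Λ ^ 2))) +
        ((4 * G₂ + 2 * G₁) * (2 * π / β) ^ 2 * 1 / klScale e₀ m ^ 2) * (4 * (β * (L : ℝ) ^ 2) / Λ)) ≤
    (1 / (β * (L : ℝ) ^ 2)) ^ 2 * (4 * (β * (L : ℝ) ^ 2) / Λ) * (4 / (s₀ * (2 * M : ℕ))) ^ 2)
  (hr₁ : (1 / (β * (L : ℝ) ^ 2)) ^ 2 *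
      (1 * ((32 * B₂ + 144 * B₁ + 128) * (β * (L : ℝ) ^ 2) / Λ ^ 3 * (K₁ * (Real.sqrt 2 * ℓ₁) + 4 * (K₂ * (Real.sqrt 2 * ℓ₁) ^ 2)) ^ 2 +
          (16 * B₁ + 16) * (β * (L : ℝ) ^ 2) / Λ ^ 2 * (K₂ * (Real.sqrt 2 * ℓ₁) ^ 2)) +
        2 * (Ae1 * ((16 * B₁ + 16) * (β * (L : ℝ) ^ 2) / Λ ^ 2 * (K₁ * (Real.sqrt 2 * ℓ₁) + 3 * (K₂ * (Real.sqrt 2 * ℓ₁) ^ 2)))) +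
        Ae2 * (4 * (β * (L : ℝ) ^ 2) / Λ)) ≤
    (1 / (β * (L : ℝ) ^ 2)) ^ 2 * (4 * (β * (L : ℝ) ^ 2) / Λ) * (4 / (s₁ * L)) ^ 2)
  (hr₂ : (1 / (β * (L : ℝ) ^ 2)) ^ 2 *
      (1 * ((32 * B₂ + 144 * B₁ + 128) * (β * (L : ℝ) ^ 2) / Λ ^ 3 * (K₁ * (Real.sqrt 2 * ℓ) + 4 * (K₂ * (Real.sqrt 2 * ℓ) ^ 2)) ^ 2 +
          (16 * B₁ + 16) * (β * (L : ℝ) ^ 2) / Λ ^ 2 * (K₂ * (Real.sqrt 2 * ℓ) ^ 2)) +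
        2 * (An1 * ((16 * B₁ + 16) * (β * (L : ℝ) ^ 2) / Λ ^ 2 * (K₁ * (Real.sqrt 2 * ℓ) + 3 * (K₂ * (Real.sqrt 2 * ℓ) ^ 2)))) +
        An2 * (4 * (β * (L : ℝ) ^ 2) / Λ)) ≤
    (1 / (β * (L : ℝ) ^ 2)) ^ 2 * (4 * (β * (L : ℝ) ^ 2) / Λ) * (4 / (s₂ * L)) ^ 2)
  (hr₃ : (1 / (β * (L : ℝ) ^ 2)) ^ 2 *
      (1 * ((32 * B₂ + 144 * B₁ + 128) * (β * (L : ℝ) ^ 2) / Λ ^ 3 * (τt + 4 * (K₂ * (Real.sqrt 2 * ℓ) ^ 2)) ^ 2 +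
          (16 * B₁ + 16) * (β * (L : ℝ) ^ 2) / Λ ^ 2 * (K₂ * (Real.sqrt 2 * ℓ) ^ 2)) +
        2 * (Av1 * ((16 * B₁ + 16) * (β * (L : ℝ) ^ 2) / Λ ^ 2 * (τt + 3 * (K₂ * (Real.sqrt 2 * ℓ) ^ 2)))) +
        Av2 * (4 * (β * (L : ℝ) ^ 2) / Λ)) ≤
    (1 / (β * (L : ℝ) ^ 2)) ^ 2 * (4 * (β * (L : ℝ) ^ 2) / Λ) * (4 / (s₃ * L)) ^ 2)

include B hA hADt he hz hz1 hgap h3 hlo hhi hβ hρA hMm hd hd1 hd2 hB0 hB hΛ hΛΛ' hM' hK₁ hK₂ hB₁ hB₂ hNr hLz hR₀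
  hℓ₁ hℓ hρf hG₁ hG₂ hKp hwsi hτt hAe1 hAe2 hAn1 hAn2 hAv1 hAv2 hs₀ hs₁ hs₂ hs₃ hr₀ hr₁ hr₂ hr₃ in
set_option maxHeartbeats 1600000 in
/-- **The uniform per-pair bound for the fat family** (see the module docstring). [cite: BenfattoGiulianiMastropietro2006, §2.8 (2.81)] -/
theorem slicePair_bgmFat_le (ω ω' : Fin (sectorCount (m + 1))) (v : Fin 2 → ℤ) (hv : v ≠ 0)
    (hvj : ∀ j, |(v j : ℝ)| ≤ Nr + 1 / 2) (hvlen : Nr - 1 ≤ Real.sqrt ((v 0 : ℝ) ^ 2 + (v 1 : ℝ) ^ 2))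
    (hvtan : |fderiv ℝ (fun p : Fin 2 → ℝ => frameLevel μ K (WithLp.toLp 2 p)) (klFermiPoint μ K (sectorCenter (m + 1) (ω : ℕ)))
      (fun j => 2 * π / L * (v j : ℝ))| ≤ |2 * π / L| * (4 + 2 * A)) :
    ∑ z : TorusSite 1 (2 * M) × TorusSite 2 L,
        ‖∑ q : TorusSite 1 (2 * M) × TorusSite 2 L, (torusChar q.1 z.1 * torusChar q.2 z.2) •
          ((((1 / (β * (L : ℝ) ^ 2) : ℝ) : ℂ) ^ 2 *
            (bgmFatMultiplier L M e₀ β (nambuXiCT L μ K) (m + 1) ω (⟨(q.1 0).val, ZMod.val_lt (q.1 0)⟩, q.2) *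
              bgmFatMultiplier L M e₀ β (nambuXiCT L μ K) (m + 1) ω' (⟨(q.1 0).val, ZMod.val_lt (q.1 0)⟩, q.2) *
              sliceSymbolFnXi (β * (L : ℝ) ^ 2) 0 Λ Λ' (matsubaraFreq β M ⟨(q.1 0).val, ZMod.val_lt (q.1 0)⟩)
                (nambuXiCT L μ K q.2))))‖ ≤
      Real.sqrt (2048 * (1 / s₀ + 1) *
          (4 * ((2 * Real.sqrt 2 / (s₂ * (Nr - 1)) + 2) * (2 * Real.sqrt 2 / (s₃ * (Nr - 1)) + 2))
            + 16 * (1 / s₁ + 1) ^ 2 / (1 + s₁ * R₀))) *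
        Real.sqrt (16 * (2 * M : ℕ) * (L : ℝ) ^ 2 *
          ((klScale e₀ m * β / π + 1) *
            ((Real.sqrt 2 * L * ((klScale e₀ m + (4 + 4 * A) * ρf ^ 2) / (2 * B.rhomin - 4 * A)) / π + 2) *
              (Real.sqrt 2 * L * (2 * ρf) / π + 2)))) *
        ((1 / (β * (L : ℝ) ^ 2)) ^ 2 * (4 * (β * (L : ℝ) ^ 2) / Λ)) := by
  have hL : (0 : ℝ) < L := Nat.cast_pos.2 (Nat.pos_of_ne_zero (NeZero.ne L))
  have hπ := Real.pi_pos
  have hΛm : 0 < klScale e₀ m := by rw [klScale]; positivity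
  have hA0 : 0 ≤ A := (norm_nonneg _).trans (hA 0 0 (by norm_num))
  have hK10 : 0 ≤ K₁ := le_trans (norm_nonneg _) (hK₁ 0)
  have hK20 : 0 ≤ K₂ := le_trans (norm_nonneg _) (hK₂ 0)
  have hDt : 0 < B.Dtmin - 2 * A := by linarith only [hADt]
  have hw : 0 < sectorWidth (m + 1) := sectorWidth_pos (m + 1)
  have hρf0 : 0 ≤ ρf := by
    rw [hρf]; have := B.smax_pos; have := B.Dtmin_pos; positivity
  have hℓ₁0 : 0 < ℓ₁ := by rw [hℓ₁]; positivity
  have hℓ0 : 0 < ℓ := by rw [hℓ]; positivity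
  have hG₁0 : 0 ≤ G₁ := by rw [hG₁]; positivity
  have hG₂0 : 0 ≤ G₂ := by rw [hG₂]; positivity
  have hKp0 : 0 ≤ Kp := by rw [hKp]; positivity
  have hwsi0 : 0 ≤ wsi := by rw [hwsi]; positivity
  have hlo' : a ≤ μ - A := by linarith only [hlo, he]
  have hhi' : μ + A ≤ b := by linarith only [hhi, he]
  -- the objects
  obtain ⟨S₁, hS₁⟩ : ∃ S₁ : Finset ℕ, S₁ = (range (sectorCount (m + 1))).filter
      (fun ω₁ : ℕ => ∃ δ : ℤ, |δ| ≤ 1 ∧ (sectorCount (m + 1) : ℤ) ∣ ((ω₁ : ℤ) - ((ω : ℕ) : ℤ) - δ)) := ⟨_, rfl⟩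
  obtain ⟨S₂, hS₂⟩ : ∃ S₂ : Finset ℕ, S₂ = (range (sectorCount (m + 1))).filter
      (fun ω₁ : ℕ => ∃ δ : ℤ, |δ| ≤ 1 ∧ (sectorCount (m + 1) : ℤ) ∣ ((ω₁ : ℤ) - ((ω' : ℕ) : ℤ) - δ)) := ⟨_, rfl⟩
  have hS₁r : S₁ ⊆ range (sectorCount (m + 1)) := by rw [hS₁]; exact fatNbr_subset_range (m + 1) ω
  have hS₂r : S₂ ⊆ range (sectorCount (m + 1)) := by rw [hS₂]; exact fatNbr_subset_range (m + 1) ω'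
  have hc₁ : S₁.card ≤ 3 := by rw [hS₁]; exact card_fatNbr_le_three (m + 1) ω
  have hc₂ : S₂.card ≤ 3 := by rw [hS₂]; exact card_fatNbr_le_three (m + 1) ω'
  have hcd : (S₁.card * S₂.card : ℝ) ≤ 9 := by
    have : S₁.card * S₂.card ≤ 3 * 3 := Nat.mul_le_mul hc₁ hc₂
    exact_mod_cast this
  have hcd0 : (0 : ℝ) ≤ S₁.card * S₂.card := by positivity
  obtain ⟨Z, hZdef⟩ : ∃ Z : (Fin 2 → ℝ) → ℝ, Z = fun p => gnCutoff ((π + z) ^ 2 / π ^ 2) ((π + z) ^ 2) (p 0 ^ 2) * gnCutoff ((π + z) ^ 2 / π ^ 2) ((π + z) ^ 2) (p 1 ^ 2) *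
    ((radialCutoffC (1 / 2) (momToComplex p) * ∑ a' ∈ S₁, sectorWeightCirc (m + 1) ((a' : ℕ) : ℤ) (polarAngle p)) *
      (radialCutoffC (1 / 2) (momToComplex p) * ∑ b' ∈ S₂, sectorWeightCirc (m + 1) ((b' : ℕ) : ℤ) (polarAngle p))) := ⟨_, rfl⟩
  have hZ : ∀ p, Z p = gnCutoff ((π + z) ^ 2 / π ^ 2) ((π + z) ^ 2) (p 0 ^ 2) * gnCutoff ((π + z) ^ 2 / π ^ 2) ((π + z) ^ 2) (p 1 ^ 2) *
    ((radialCutoffC (1 / 2) (momToComplex p) * ∑ a' ∈ S₁, sectorWeightCirc (m + 1) ((a' : ℕ) : ℤ) (polarAngle p)) *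
      (radialCutoffC (1 / 2) (momToComplex p) * ∑ b' ∈ S₂, sectorWeightCirc (m + 1) ((b' : ℕ) : ℤ) (polarAngle p))) :=
    fun p => by rw [hZdef]
  obtain ⟨Φ, hΦdef⟩ : ∃ Φ : ℝ × (Fin 2 → ℝ) → ℂ, Φ = fun x => ((bgmCutoffSq e₀ ((16 : ℝ) ^ m * (x.1 ^ 2 + frameLevel μ K (WithLp.toLp 2 x.2) ^ 2)) *
      bgmCutoffSq e₀ ((16 : ℝ) ^ m * (x.1 ^ 2 + frameLevel μ K (WithLp.toLp 2 x.2) ^ 2)) * Z x.2 : ℝ) : ℂ) := ⟨_, rfl⟩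
  have hΦ : ∀ k₀ p, Φ (k₀, p) = ((bgmCutoffSq e₀ ((16 : ℝ) ^ m * (k₀ ^ 2 + frameLevel μ K (WithLp.toLp 2 p) ^ 2)) *
      bgmCutoffSq e₀ ((16 : ℝ) ^ m * (k₀ ^ 2 + frameLevel μ K (WithLp.toLp 2 p) ^ 2)) * Z p : ℝ) : ℂ) := fun k₀ p => by rw [hΦdef]
  obtain ⟨Gs, hGsdef⟩ : ∃ Gs : TorusSite 1 (2 * M) × TorusSite 2 L → ℂ, Gs = fun q =>
    bgmFatMultiplier L M e₀ β (nambuXiCT L μ K) (m + 1) ω (⟨(q.1 0).val, ZMod.val_lt (q.1 0)⟩, q.2) *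
      bgmFatMultiplier L M e₀ β (nambuXiCT L μ K) (m + 1) ω' (⟨(q.1 0).val, ZMod.val_lt (q.1 0)⟩, q.2) := ⟨_, rfl⟩
  have hGsΦ : ∀ q, Gs q = Φ (π * (1 - 2 * M) / β + 2 * π / β * (((q.1 0).val : ℕ) : ℝ), fun j => 2 * π / L * (((q.2 j).valMinAbs : ℤ) : ℝ)) := by
    intro q; rw [hGsdef]
    subst hS₁ hS₂
    exact bgmFat_mul_bgmFat_eq_symbol hA he hz h3 m ω ω' hZ hΦ q
  -- the displacement of the neighbouring Fermi points
  have hδ : ∀ a' ∈ S₁, ‖klFermiPoint μ K (sectorCenter (m + 1) a') - klFermiPoint μ K (sectorCenter (m + 1) (ω : ℕ))‖ ≤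
      π * Real.sqrt 2 * (1 + (4 + 2 * A) / (B.Dtmin - 2 * A)) * sectorWidth (m + 1) :=
    fun a' ha' => norm_klFermiPoint_fatNbr_sub_le B hA hlo' hhi' hADt (m + 1) ω (hS₁ ▸ ha')
  have hδF0 : 0 ≤ π * Real.sqrt 2 * (1 + (4 + 2 * A) / (B.Dtmin - 2 * A)) * sectorWidth (m + 1) := by positivity
  have hρfeq : (klScale e₀ m + B.smax * B.Dtmin * (3 * sectorWidth (m + 1) / 4)) / (B.Dtmin - 2 * A) +
      π * Real.sqrt 2 * (1 + (4 + 2 * A) / (B.Dtmin - 2 * A)) * sectorWidth (m + 1) = ρf := hρf.symm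
  -- multiplier data: sup and support
  have hM0 : ∀ q, ‖Gs q‖ ≤ 1 := fun q => by
    have := fatPair_norm_le_one_mul_one hS₁r hS₂r hZ hΦ hGsΦ q; simpa using this
  have hNs := card_support_fatPair_le B hA hADt he hz hz1 hgap hlo hhi hβ hρA (le_refl m) hδF0 hδ hd hd1 hd2 hZ hΦ hGsΦ
  rw [hρfeq] at hNs
  -- time differences
  have hMt₁ : ∀ q, ‖fwdDiff ((fun _ : Fin 1 => (1 : ZMod (2 * M))), (0 : TorusSite 2 L)) Gs q‖ ≤ 2 * G₁ * |2 * π / β| * 1 / klScale e₀ m := by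
    intro q; rw [hG₁]
    exact norm_fwdDiff_time_fatPair_le he hβ (le_refl m) hS₁r hS₂r hd hd1 hd2 hZ hΦ hGsΦ hMm q
  have hMt₂ : ∀ q, ‖(fwdDiff ((fun _ : Fin 1 => (1 : ZMod (2 * M))), (0 : TorusSite 2 L)))^[2] Gs q‖ ≤
      (4 * G₂ + 2 * G₁) * (2 * π / β) ^ 2 * 1 / klScale e₀ m ^ 2 := by
    intro q; rw [hG₁, hG₂]
    exact norm_fwdDiff_two_time_fatPair_le he hβ (le_refl m) hS₁r hS₂r hd hd1 hd2 hZ hΦ hGsΦ hMm q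
  have hat₁ : 0 ≤ 2 * G₁ * |2 * π / β| * 1 / klScale e₀ m := by positivity
  have hat₂ : 0 ≤ (4 * G₂ + 2 * G₁) * (2 * π / β) ^ 2 * 1 / klScale e₀ m ^ 2 := by positivity
  -- space differences along an integer step `u` with `|u_j| ≤ Nr + 1/2` and tangency datum `τ₀`
  have hstep : ∀ (u : Fin 2 → ℤ), (∀ j, |(u j : ℝ)| ≤ Nr + 1 / 2) → ∀ {τ₀ τb nb : ℝ}, 0 ≤ τ₀ → τ₀ ≤ τb →
      ‖(fun j => 2 * π / L * (u j : ℝ))‖ ≤ nb → 0 ≤ nb →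
      |fderiv ℝ (fun p : Fin 2 → ℝ => frameLevel μ K (WithLp.toLp 2 p)) (klFermiPoint μ K (sectorCenter (m + 1) (ω : ℕ)))
        (fun j => 2 * π / L * (u j : ℝ))| ≤ τ₀ →
      (∀ q, ‖fwdDiff ((0 : TorusSite 1 (2 * M)), (fun j => ((u j : ℤ) : ZMod L))) Gs q‖ ≤
          2 * G₁ * (τb + Kp * (ρf + 2 * nb) * nb) / klScale e₀ m * 1 + 1 * 1 * (9 * (4 * Ba * ((1 + 2 * wsi) * (2 * nb))))) ∧
      (∀ q, ‖((fwdDiff ((0 : TorusSite 1 (2 * M)), (fun j => ((u j : ℤ) : ZMod L))))^[2] Gs) q‖ ≤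
          ((4 * G₂ + 2 * G₁) * (τb + Kp * (ρf + 2 * nb) * nb) ^ 2 / klScale e₀ m ^ 2 + 2 * G₁ * (Kp * nb ^ 2) / klScale e₀ m) * 1 +
            4 * G₁ * (τb + Kp * (ρf + 2 * nb) * nb) / klScale e₀ m * (9 * (4 * Ba * ((1 + 2 * wsi) * (2 * nb)))) +
            1 * 1 * (9 * (4 * Ba * ((1 + 2 * wsi) * (2 * nb)) ^ 2 + 8 * Ba ^ 2 * ((1 + 2 * wsi) * (2 * nb)) ^ 2))) := by
    intro u huj τ₀ τb nb hτ00 hτb hnb hnb0 hτ₀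
    have hu : ∀ j, 2 * |2 * π / (L : ℝ)| * |(u j : ℝ)| ≤ z := fun j =>
      le_trans (mul_le_mul_of_nonneg_left (huj j) (by positivity)) hLz
    have hnc : ‖momToComplex (fun j => 2 * π / L * (u j : ℝ))‖ ≤ 2 * nb := by
      have hWj : ∀ j, |2 * π / L * (u j : ℝ)| ≤ nb := fun j => by
        have h := norm_le_pi_norm (fun j => 2 * π / L * (u j : ℝ)) j
        rw [Real.norm_eq_abs] at h
        exact h.trans hnb
      have hsq : ‖momToComplex (fun j => 2 * π / L * (u j : ℝ))‖ ^ 2 ≤ (2 * nb) ^ 2 := by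
        rw [norm_momToComplex_sq]
        have h0 := hWj 0; have h1 := hWj 1
        have e0 : (2 * π / L * (u 0 : ℝ)) ^ 2 = |2 * π / L * (u 0 : ℝ)| ^ 2 := (sq_abs _).symm
        have e1 : (2 * π / L * (u 1 : ℝ)) ^ 2 = |2 * π / L * (u 1 : ℝ)| ^ 2 := (sq_abs _).symm
        rw [e0, e1]
        nlinarith only [h0, h1, abs_nonneg (2 * π / L * (u 0 : ℝ)), abs_nonneg (2 * π / L * (u 1 : ℝ))]
      exact (pow_le_pow_iff_left₀ (norm_nonneg _) (by positivity) two_ne_zero).1 hsq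
    have h2 := norm_fwdDiff_two_space_fatPair_le B hA hADt he hz hz1 hgap h3 hlo hhi (le_refl m) hS₁r hS₂r hδF0 hδ hd hd1 hd2 hZ hΦ hGsΦ
      hB0 hB u hu hτ₀
    have h1 := norm_fwdDiff_space_fatPair_le B hA hADt he hz hz1 hgap h3 hlo hhi (le_refl m) hS₁r hS₂r hδF0 hδ hd hd1 hd2 hZ hΦ hGsΦ
      hB0 hB u hu hτ₀
    rw [hρfeq] at h1 h2
    refine ⟨fun q => (h1 q).trans ?_, fun q => (h2 q).trans ?_⟩
    · rw [hG₁, hKp, hwsi]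
      exact fatPair_a1_mono (by positivity) (by positivity) hρf0 hΛm hB0 (by positivity) hτb (norm_nonneg _) hnb (norm_nonneg _) hnc hcd0 hcd
    · rw [hG₁, hG₂, hKp, hwsi]
      exact fatPair_a2_mono (by positivity) (by positivity) (by positivity) hρf0 hΛm hB0 (by positivity) hτ00 hτb (norm_nonneg _) hnb
        (norm_nonneg _) hnc hcd0 hcd
  -- sup norms of the steps
  have hnorm_u : ∀ (u : Fin 2 → ℤ) (b : ℝ), (∀ j, |(u j : ℝ)| ≤ b) → ‖(fun j => 2 * π / L * (u j : ℝ))‖ ≤ 2 * π / L * b := by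
    intro u b hb
    refine (pi_norm_le_iff_of_nonneg (by
      have : 0 ≤ b := (abs_nonneg _).trans (hb 0); positivity)).2 fun j => ?_
    rw [Real.norm_eq_abs, abs_mul, abs_of_pos (by positivity : (0:ℝ) < 2 * π / L)]
    exact mul_le_mul_of_nonneg_left (hb j) (by positivity)
  -- axes
  have haxes : ∀ i : Fin 2,
      (∀ q, ‖fwdDiff ((0 : TorusSite 1 (2 * M)), (Pi.single i (1 : ZMod L) : TorusSite 2 L)) Gs q‖ ≤ Ae1) ∧
      (∀ q, ‖((fwdDiff ((0 : TorusSite 1 (2 * M)), (Pi.single i (1 : ZMod L) : TorusSite 2 L)))^[2] Gs) q‖ ≤ Ae2) := by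
    intro i
    have huj : ∀ j, |(((Pi.single i (1 : ℤ) : Fin 2 → ℤ) j : ℤ) : ℝ)| ≤ Nr + 1 / 2 := by
      intro j; by_cases h : j = i
      · subst h; simp; linarith only [hNr]
      · simp [h]; linarith only [hNr]
    have hub : ∀ j, |(((Pi.single i (1 : ℤ) : Fin 2 → ℤ) j : ℤ) : ℝ)| ≤ 1 := by
      intro j; by_cases h : j = i
      · subst h; simp
      · simp [h]
    have hnb : ‖(fun j => 2 * π / L * (((Pi.single i (1 : ℤ) : Fin 2 → ℤ) j : ℤ) : ℝ))‖ ≤ ℓ₁ := by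
      rw [hℓ₁]; have := hnorm_u (Pi.single i 1) 1 hub; simpa using this
    have hτ₀ := abs_fderiv_frameBand_apply_le hA μ (klFermiPoint μ K (sectorCenter (m + 1) (ω : ℕ)))
      (fun j => 2 * π / L * (((Pi.single i (1 : ℤ) : Fin 2 → ℤ) j : ℤ) : ℝ))
    have hτb : (4 + 2 * A) * ‖(fun j => 2 * π / L * (((Pi.single i (1 : ℤ) : Fin 2 → ℤ) j : ℤ) : ℝ))‖ ≤ (4 + 2 * A) * ℓ₁ :=
      mul_le_mul_of_nonneg_left hnb (by positivity)
    obtain ⟨h1, h2⟩ := hstep (Pi.single i 1) huj (by positivity) hτb hnb hℓ₁0.le hτ₀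
    rw [← single_zmod_eq_intCast_single i] at h1 h2
    refine ⟨fun q => (h1 q).trans (le_of_eq hAe1.symm), fun q => (h2 q).trans (le_of_eq hAe2.symm)⟩
  -- normal direction
  have hvb : ‖(fun j => 2 * π / L * (v j : ℝ))‖ ≤ ℓ := by rw [hℓ]; exact hnorm_u v _ hvj
  have hnormal :
      (∀ q, ‖fwdDiff ((0 : TorusSite 1 (2 * M)), (fun j => (((![-v 1, v 0] : Fin 2 → ℤ) j : ℤ) : ZMod L))) Gs q‖ ≤ An1) ∧
      (∀ q, ‖((fwdDiff ((0 : TorusSite 1 (2 * M)), (fun j => (((![-v 1, v 0] : Fin 2 → ℤ) j : ℤ) : ZMod L))))^[2] Gs) q‖ ≤ An2) := by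
    have huj : ∀ j, |(((![-v 1, v 0] : Fin 2 → ℤ) j : ℤ) : ℝ)| ≤ Nr + 1 / 2 := by
      intro j; fin_cases j
      · show |(((-v 1 : ℤ) : ℤ) : ℝ)| ≤ Nr + 1 / 2
        rw [Int.cast_neg, abs_neg]; exact hvj 1
      · exact hvj 0
    have hnb : ‖(fun j => 2 * π / L * (((![-v 1, v 0] : Fin 2 → ℤ) j : ℤ) : ℝ))‖ ≤ ℓ := by rw [hℓ]; exact hnorm_u _ _ huj
    have hτ₀ := abs_fderiv_frameBand_apply_le hA μ (klFermiPoint μ K (sectorCenter (m + 1) (ω : ℕ)))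
      (fun j => 2 * π / L * (((![-v 1, v 0] : Fin 2 → ℤ) j : ℤ) : ℝ))
    have hτb : (4 + 2 * A) * ‖(fun j => 2 * π / L * (((![-v 1, v 0] : Fin 2 → ℤ) j : ℤ) : ℝ))‖ ≤ (4 + 2 * A) * ℓ :=
      mul_le_mul_of_nonneg_left hnb (by positivity)
    obtain ⟨h1, h2⟩ := hstep (![-v 1, v 0]) huj (by positivity) hτb hnb hℓ0.le hτ₀
    exact ⟨fun q => (h1 q).trans (le_of_eq hAn1.symm), fun q => (h2 q).trans (le_of_eq hAn2.symm)⟩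
  -- tangent direction
  have htangent :
      (∀ q, ‖fwdDiff ((0 : TorusSite 1 (2 * M)), (fun j => ((v j : ℤ) : ZMod L))) Gs q‖ ≤ Av1) ∧
      (∀ q, ‖((fwdDiff ((0 : TorusSite 1 (2 * M)), (fun j => ((v j : ℤ) : ZMod L))))^[2] Gs) q‖ ≤ Av2) := by
    obtain ⟨h1, h2⟩ := hstep v hvj (by positivity) le_rfl hvb hℓ0.le hvtan
    exact ⟨fun q => (h1 q).trans (le_of_eq hAv1.symm), fun q => (h2 q).trans (le_of_eq hAv2.symm)⟩
  -- the Euclidean tangency datum of the slice profile on the support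
  have hcell : ∀ q, Gs q ≠ 0 → ‖torusCentredMomentum L q.2 - klFermiPoint μ K (sectorCenter (m + 1) (ω : ℕ))‖ ≤ ρf := by
    intro q hq
    rw [hGsΦ q, hΦ] at hq
    have hq' : bgmCutoffSq e₀ ((16 : ℝ) ^ m * ((π * (1 - 2 * M) / β + 2 * π / β * (((q.1 0).val : ℕ) : ℝ)) ^ 2 +
        frameLevel μ K (WithLp.toLp 2 fun j => 2 * π / L * (((q.2 j).valMinAbs : ℤ) : ℝ)) ^ 2)) *
        bgmCutoffSq e₀ ((16 : ℝ) ^ m * ((π * (1 - 2 * M) / β + 2 * π / β * (((q.1 0).val : ℕ) : ℝ)) ^ 2 +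
        frameLevel μ K (WithLp.toLp 2 fun j => 2 * π / L * (((q.2 j).valMinAbs : ℤ) : ℝ)) ^ 2)) *
        Z (fun j => 2 * π / L * (((q.2 j).valMinAbs : ℤ) : ℝ)) ≠ 0 := fun h0 => hq (by rw [h0]; simp)
    obtain ⟨-, -, -, -, hGv⟩ := scaleProfile_mul_bounds he (le_refl m) hd hd1 hd2
    obtain ⟨-, hshell, hZne⟩ := symbol_support hΛm hGv (fun p : Fin 2 → ℝ => frameLevel μ K (WithLp.toLp 2 p)) Z hq'
    have hsq : ∀ i, |(fun j => 2 * π / L * (((q.2 j).valMinAbs : ℤ) : ℝ)) i| ≤ π + z := by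
      intro i
      have := abs_torusCentredMomentum_le_pi L q.2 i
      rw [torusCentredMomentum_eq_valMinAbs] at this
      linarith only [this, hz]
    have h := fatPair_cell B hA hADt he hz hz1 hgap hlo hhi hδ hZ _ hsq hshell hZne
    rw [hρfeq, ← torusCentredMomentum_eq_valMinAbs] at h
    exact h
  have hτE : ∀ q, Gs q ≠ 0 → |fderiv ℝ (frameLevel μ K) (WithLp.toLp 2 (torusCentredMomentum L q.2)) (WithLp.toLp 2 (fun i => 2 * π / L * (v i : ℝ)))| ≤
      |2 * π / L| * (4 + 2 * A) + K₂ * (Real.sqrt 2 * ρf) * ‖(WithLp.toLp 2 (fun i => 2 * π / L * (v i : ℝ)) : EuclideanSpace ℝ (Fin 2))‖ :=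
    fun q hq => sliceTangency_of_cell μ K hK₂ Gs v _ hvtan hcell q hq
  have hne : ‖(WithLp.toLp 2 (fun i => 2 * π / L * (v i : ℝ)) : EuclideanSpace ℝ (Fin 2))‖ ≤ Real.sqrt 2 * ℓ :=
    (norm_toLp_le _).trans (mul_le_mul_of_nonneg_left hvb (Real.sqrt_nonneg 2))
  have hτ0 : 0 ≤ |2 * π / L| * (4 + 2 * A) + K₂ * (Real.sqrt 2 * ρf) * ‖(WithLp.toLp 2 (fun i => 2 * π / L * (v i : ℝ)) : EuclideanSpace ℝ (Fin 2))‖ := by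
    positivity
  have hττt : |2 * π / L| * (4 + 2 * A) + K₂ * (Real.sqrt 2 * ρf) * ‖(WithLp.toLp 2 (fun i => 2 * π / L * (v i : ℝ)) : EuclideanSpace ℝ (Fin 2))‖ ≤ τt := by
    rw [hτt]; gcongr
  -- the rate inequalities on the ACTUAL data follow from the uniform ones by monotonicity
  have hR₀' : 2 * (|v 0| + |v 1|) * (R₀ : ℤ) < L := by
    have h0 := hvj 0; have h1 := hvj 1
    have : (2 * (|(v 0 : ℝ)| + |(v 1 : ℝ)|)) * (R₀ : ℝ) ≤ 2 * (2 * Nr + 1) * (R₀ : ℝ) :=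
      mul_le_mul_of_nonneg_right (by linarith only [h0, h1]) (Nat.cast_nonneg _)
    have : ((2 * (|v 0| + |v 1|) * (R₀ : ℤ) : ℤ) : ℝ) < (L : ℝ) := by
      push_cast; rw [← Int.cast_abs, ← Int.cast_abs]; push_cast; linarith only [this, hR₀]
    exact_mod_cast this
  have hne_axis : ∀ i : Fin 2, ‖(WithLp.toLp 2 (fun j => 2 * π / L * ((Pi.single i (1 : ℤ) : Fin 2 → ℤ) j : ℝ)) : EuclideanSpace ℝ (Fin 2))‖ ≤
      Real.sqrt 2 * ℓ₁ := by
    intro i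
    refine (norm_toLp_le _).trans (mul_le_mul_of_nonneg_left ?_ (Real.sqrt_nonneg 2))
    rw [hℓ₁]
    have hub : ∀ j, |(((Pi.single i (1 : ℤ) : Fin 2 → ℤ) j : ℤ) : ℝ)| ≤ 1 := by
      intro j; by_cases h : j = i
      · subst h; simp
      · simp [h]
    have := hnorm_u (Pi.single i 1) 1 hub; simpa using this
  have hne_n : ‖(WithLp.toLp 2 (fun j => 2 * π / L * ((![-v 1, v 0] : Fin 2 → ℤ) j : ℝ)) : EuclideanSpace ℝ (Fin 2))‖ ≤ Real.sqrt 2 * ℓ := by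
    refine (norm_toLp_le _).trans (mul_le_mul_of_nonneg_left ?_ (Real.sqrt_nonneg 2))
    rw [hℓ]
    refine hnorm_u _ _ fun j => ?_
    fin_cases j
    · show |(((-v 1 : ℤ) : ℤ) : ℝ)| ≤ Nr + 1 / 2
      rw [Int.cast_neg, abs_neg]; exact hvj 1
    · exact hvj 0
  have hc0 : (0 : ℝ) ≤ (1 / (β * (L : ℝ) ^ 2)) ^ 2 := by positivity
  have hC₂ : 0 ≤ 32 * B₂ + 144 * B₁ + 128 := by
    have : 0 ≤ B₁ := (abs_nonneg _).trans (hB₁ 0); have : 0 ≤ B₂ := (abs_nonneg _).trans (hB₂ 0); positivity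
  have hC₁ : 0 ≤ 16 * B₁ + 16 := by have : 0 ≤ B₁ := (abs_nonneg _).trans (hB₁ 0); positivity
  have hcβ : 0 ≤ β * (L : ℝ) ^ 2 := by positivity
  have hAe10 : 0 ≤ Ae1 := by rw [hAe1]; positivity
  have hAe20 : 0 ≤ Ae2 := by rw [hAe2]; positivity
  have hAn10 : 0 ≤ An1 := by rw [hAn1]; positivity
  have hAn20 : 0 ≤ An2 := by rw [hAn2]; positivity
  have hAv10 : 0 ≤ Av1 := by rw [hAv1]; positivity
  have hAv20 : 0 ≤ Av2 := by rw [hAv2]; positivity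
  have hmain := slicePair_charSum_l1_le (K := K) hβ hΛ hΛΛ' hM' hK₁ hK₂ hB₁ hB₂ Gs hM0 le_rfl v hv hR₀' hat₁ hat₂ hMt₁ hMt₂
    (fun _ => Ae1) (fun _ => Ae2) (fun _ => hAe10) (fun _ => hAe20) (fun q i => (haxes i).1 q) (fun q i => (haxes i).2 q)
    hAn10 hAn20 hnormal.1 hnormal.2 hAv10 hAv20 htangent.1 htangent.2 hτ0 hτE hs₀ hs₁ hs₂ hs₃ hr₀
    (fun i => le_trans (slicePair_lhs_mono (s₀ := 3) hc0 hC₂ hC₁ hcβ hΛ hK20 (by norm_num) hAe10 le_rfl le_rfl (norm_nonneg _) (hne_axis i)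
      (by positivity) (mul_le_mul_of_nonneg_left (hne_axis i) hK10)) (hr₁))
    (le_trans (slicePair_lhs_mono (s₀ := 3) hc0 hC₂ hC₁ hcβ hΛ hK20 (by norm_num) hAn10 le_rfl le_rfl (norm_nonneg _) hne_n
      (by positivity) (mul_le_mul_of_nonneg_left hne_n hK10)) hr₂)
    (le_trans (slicePair_lhs_mono (s₀ := 3) hc0 hC₂ hC₁ hcβ hΛ hK20 (by norm_num) hAv10 le_rfl le_rfl (norm_nonneg _) hne hτ0 hττt) hr₃)
  -- final comparison: support count and the length of `v`
  have hLHS : ∀ q : TorusSite 1 (2 * M) × TorusSite 2 L,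
      bgmFatMultiplier L M e₀ β (nambuXiCT L μ K) (m + 1) ω (⟨(q.1 0).val, ZMod.val_lt (q.1 0)⟩, q.2) *
        bgmFatMultiplier L M e₀ β (nambuXiCT L μ K) (m + 1) ω' (⟨(q.1 0).val, ZMod.val_lt (q.1 0)⟩, q.2) *
        sliceSymbolFnXi (β * (L : ℝ) ^ 2) 0 Λ Λ' (matsubaraFreq β M ⟨(q.1 0).val, ZMod.val_lt (q.1 0)⟩) (nambuXiCT L μ K q.2) =
      Gs q * sliceSymbolFnXi (β * (L : ℝ) ^ 2) 0 Λ Λ' (matsubaraFreq β M ⟨(q.1 0).val, ZMod.val_lt (q.1 0)⟩) (nambuXiCT L μ K q.2) := by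
    intro q; rw [hGsdef]
  simp_rw [hLHS]
  refine hmain.trans ?_
  have hA₀ : 0 ≤ (1 / (β * (L : ℝ) ^ 2)) ^ 2 * (4 * (β * (L : ℝ) ^ 2) / Λ) := by positivity
  have hvpos : 0 < Real.sqrt ((v 0 : ℝ) ^ 2 + (v 1 : ℝ) ^ 2) := lt_of_lt_of_le (by linarith only [hNr]) hvlen
  have hNr1 : 0 < Nr - 1 := by linarith only [hNr]
  have hW : 2048 * (1 / s₀ + 1) *
        (4 * ((2 * Real.sqrt 2 / (s₂ * Real.sqrt ((v 0 : ℝ) ^ 2 + (v 1 : ℝ) ^ 2)) + 2) *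
            (2 * Real.sqrt 2 / (s₃ * Real.sqrt ((v 0 : ℝ) ^ 2 + (v 1 : ℝ) ^ 2)) + 2))
          + 16 * (1 / s₁ + 1) ^ 2 / (1 + s₁ * R₀)) ≤
      2048 * (1 / s₀ + 1) *
        (4 * ((2 * Real.sqrt 2 / (s₂ * (Nr - 1)) + 2) * (2 * Real.sqrt 2 / (s₃ * (Nr - 1)) + 2))
          + 16 * (1 / s₁ + 1) ^ 2 / (1 + s₁ * R₀)) := by
    have h2 : 2 * Real.sqrt 2 / (s₂ * Real.sqrt ((v 0 : ℝ) ^ 2 + (v 1 : ℝ) ^ 2)) ≤ 2 * Real.sqrt 2 / (s₂ * (Nr - 1)) :=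
      div_le_div_of_nonneg_left (by positivity) (by positivity) (mul_le_mul_of_nonneg_left hvlen hs₂.le)
    have h3 : 2 * Real.sqrt 2 / (s₃ * Real.sqrt ((v 0 : ℝ) ^ 2 + (v 1 : ℝ) ^ 2)) ≤ 2 * Real.sqrt 2 / (s₃ * (Nr - 1)) :=
      div_le_div_of_nonneg_left (by positivity) (by positivity) (mul_le_mul_of_nonneg_left hvlen hs₃.le)
    have h20 : 0 ≤ 2 * Real.sqrt 2 / (s₂ * Real.sqrt ((v 0 : ℝ) ^ 2 + (v 1 : ℝ) ^ 2)) := by positivity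
    have h30 : 0 ≤ 2 * Real.sqrt 2 / (s₃ * Real.sqrt ((v 0 : ℝ) ^ 2 + (v 1 : ℝ) ^ 2)) := by positivity
    gcongr
  have hcardR : (16 * ((2 * M : ℕ) : ℝ) * (L : ℝ) ^ 2 * (((univ.filter fun q => Gs q ≠ 0).card : ℕ) : ℝ)) ≤
      16 * ((2 * M : ℕ) : ℝ) * (L : ℝ) ^ 2 *
        ((klScale e₀ m * β / π + 1) *
          ((Real.sqrt 2 * L * ((klScale e₀ m + (4 + 4 * A) * ρf ^ 2) / (2 * B.rhomin - 4 * A)) / π + 2) *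
            (Real.sqrt 2 * L * (2 * ρf) / π + 2))) :=
    mul_le_mul_of_nonneg_left hNs (by positivity)
  gcongr

end PairBound

end Summit.HubbardSuperconductivity.HubbardSuperconductivity.Theorems.TorusFourierL2

end
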